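import Summits.ResolutionOfSingularities.ResolutionOfSingularities.Theorems.FrobeniusClosingPatchingRelPerfectMonomialRouteKRealisation
import Literature.AlgebraicGeometry.Resolution.BlowupSequencesExtensions
import Literature.AlgebraicGeometry.Resolution.GenericFibreResolutionDatum
import HarnessLib

/-!
# Crux `PatchingRelPerfect` (stmt-ResolutionOfSingularities-16161), chain w52 — TargetsF3 (m)
# «M2-strong», COMBINATORIAL HALF, Route K step K3(a): the TORUS SCALINGS are automorphisms of the
# realised triple, hence every centre of the functorial resolution is scaling-stable at every level

[OURS · L1 W5.2 · res-L1-w52-plan-1 RULING «Route K approved» 07:37:28Z; fact-free; nothing here is a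
statement of the manuscript under review]

For `t : ↥B → ℚ` with all `t b ≠ 0`, the scaling `x_b ↦ t_b x_b` is a `ℚ`-algebra automorphism
`scaleEquiv t` of `ℚ[x_B]`, hence an automorphism `scale t` of `𝔸^B_ℚ`; it preserves every `D(m_T)`,
so it restricts to an automorphism `scaleX s t` of the realised scheme `X_s` (file K1), it fixes the
monomial ideal (`map_scale_genIdeal`), so `(X_s, I_s, ∅)` is its own pull-back along `scaleX s t`
(`isPullbackAlong_scaleX`).  By functoriality of Kollár's blow-up sequence functor
(`CommutesWithSmoothMorphisms`, surjective case) the resolution sequence `𝔰 = 𝓑𝓜𝓞_m(X_s, I_s, ∅)`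
therefore satisfies `𝔰 = 𝔰.comap (scaleX s t)`, i.e. **`CentreSeq.IsPullbackAlong (scaleX s t) 𝔰 𝔰`**
(`selfPullback_of_functorial`): unfolding with `isPullbackAlong_cons_cons`, the first centre `C`
satisfies `C = C.comap (scaleX s t)` and the rest of the sequence is its own pull-back along a lift of
the scaling to `Bl_C X_s` — the input of K3(c) (stable + regular + irreducible ⇒ a closed stratum).
-/

-- `Summit.<Summit>.<Sub>.Theorems` with `Sub = Summit` (single-conjunct summit, D-0017)
set_option linter.dupNamespace false

noncomputable section

open CategoryTheory AlgebraicGeometry MvPolynomial Literature.AlgebraicGeometry.Resolution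

namespace Summit.ResolutionOfSingularities.ResolutionOfSingularities.Theorems

namespace PolyhedraGame

namespace RouteK

variable {B : Finset ℕ}

/-! ## The scaling automorphism of `ℚ[x_B]` -/

/-- [OURS] The scaling substitution `x_b ↦ t_b · x_b` as an algebra endomorphism. -/
def scaleHom (t : B → ℚ) : R B →ₐ[ℚ] R B := aeval fun b => C (t b) * MvPolynomial.X b

/-- [OURS] On variables. -/
@[simp] theorem scaleHom_X (t : B → ℚ) (b : B) :
    scaleHom t (MvPolynomial.X b) = C (t b) * MvPolynomial.X b := by
  simp [scaleHom]

/-- [OURS] Scalings compose by multiplying the factors. -/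
theorem scaleHom_comp (t u : B → ℚ) :
    (scaleHom t).comp (scaleHom u) = scaleHom (fun b => t b * u b) := by
  apply MvPolynomial.algHom_ext
  intro b
  simp only [AlgHom.coe_comp, Function.comp_apply, scaleHom_X, map_mul]
  rw [scaleHom, aeval_C, algebraMap_eq]
  ring

/-- [OURS] The trivial scaling is the identity. -/
theorem scaleHom_one : scaleHom (fun _ : B => (1 : ℚ)) = AlgHom.id ℚ (R B) := by
  apply MvPolynomial.algHom_ext
  intro b
  simp [scaleHom]

/-- [OURS] The scaling by non-zero factors as an algebra AUTOMORPHISM (inverse: the inverse factors). -/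
def scaleEquiv (t : B → ℚ) (ht : ∀ b, t b ≠ 0) : R B ≃ₐ[ℚ] R B :=
  AlgEquiv.ofAlgHom (scaleHom t) (scaleHom fun b => (t b)⁻¹)
    (by rw [scaleHom_comp]; convert scaleHom_one (B := B) using 2; funext b; simp [ht b])
    (by rw [scaleHom_comp]; convert scaleHom_one (B := B) using 2; funext b; simp [ht b])

/-- [OURS] Unfolding. -/
@[simp] theorem scaleEquiv_apply (t : B → ℚ) (ht : ∀ b, t b ≠ 0) (f : R B) :
    scaleEquiv t ht f = scaleHom t f := rfl

/-- [OURS] A scaling multiplies a monomial by a unit scalar. -/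
theorem scaleHom_monomial (t : B → ℚ) (m : B →₀ ℕ) (a : ℚ) :
    scaleHom t (monomial m a) = C (m.prod fun b k => t b ^ k) * monomial m a := by
  unfold scaleHom
  rw [aeval_monomial, Finsupp.prod, Finsupp.prod]
  simp only [mul_pow, ← map_pow, Finset.prod_mul_distrib, ← map_prod]
  rw [monomial_eq, MvPolynomial.algebraMap_eq, Finsupp.prod]
  ring

/-- [OURS] The scalar is a unit. -/
theorem prod_pow_ne_zero (t : B → ℚ) (ht : ∀ b, t b ≠ 0) (m : B →₀ ℕ) :
    (m.prod fun b k => t b ^ k) ≠ 0 := by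
  rw [Finsupp.prod]
  exact Finset.prod_ne_zero_iff.mpr fun b _ => pow_ne_zero _ (ht b)

/-- [OURS] The co-monomials `m_T` are scaled by a unit. -/
theorem scaleHom_coMonomial (t : B → ℚ) (T : Finset ℕ) :
    ∃ c : ℚ, scaleHom t (coMonomial B T) = C c * coMonomial B T ∧
      ((∀ b, t b ≠ 0) → c ≠ 0) := by
  classical
  refine ⟨∏ b ∈ B.attach with b.1 ∉ T, t b, ?_, fun ht => Finset.prod_ne_zero_iff.mpr fun b _ => ht b⟩
  unfold coMonomial
  rw [map_prod, map_prod]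
  simp only [scaleHom_X]
  rw [Finset.prod_mul_distrib]

/-- [OURS] **The monomial ideal is stable under scalings**: `genIdeal.map (scaleHom t) = genIdeal`
for non-zero factors. -/
theorem map_scale_genIdeal (s : State) (t : s.B → ℚ) (ht : ∀ b, t b ≠ 0) :
    (genIdeal s).map (scaleHom t) = genIdeal s := by
  apply le_antisymm
  · rw [genIdeal, Ideal.map_span]
    apply Ideal.span_le.mpr
    rintro _ ⟨_, ⟨α, hα, rfl⟩, rfl⟩
    change scaleHom t (genMonomial s.B α) ∈ genIdeal s
    rw [genMonomial, scaleHom_monomial]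
    exact Ideal.mul_mem_left _ _ (Ideal.subset_span ⟨α, hα, rfl⟩)
  · intro f hf
    -- `f = scale t (scale t⁻¹ f)` and `scale t⁻¹ f ∈ genIdeal`
    have hinv : ∀ g ∈ genIdeal s, scaleHom (fun b => (t b)⁻¹) g ∈ genIdeal s := by
      intro g hg
      have h1 : (genIdeal s).map (scaleHom fun b => (t b)⁻¹) ≤ genIdeal s := by
        rw [genIdeal, Ideal.map_span]
        apply Ideal.span_le.mpr
        rintro _ ⟨_, ⟨α, hα, rfl⟩, rfl⟩
        change scaleHom _ (genMonomial s.B α) ∈ genIdeal s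
        rw [genMonomial, scaleHom_monomial]
        exact Ideal.mul_mem_left _ _ (Ideal.subset_span ⟨α, hα, rfl⟩)
      exact h1 (Ideal.mem_map_of_mem _ hg)
    have hf' : f = scaleHom t (scaleHom (fun b => (t b)⁻¹) f) := by
      change f = ((scaleHom t).comp (scaleHom fun b => (t b)⁻¹)) f
      rw [scaleHom_comp]
      have : (fun b => t b * (t b)⁻¹) = fun _ : s.B => (1 : ℚ) := by funext b; simp [ht b]
      rw [this, scaleHom_one]; rfl
    rw [hf']
    exact Ideal.mem_map_of_mem _ (hinv f hf)

/-! ## The scaling of `𝔸^B` and of `X_s` -/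

/-- [OURS] The scaling automorphism of `𝔸^B_ℚ`. -/
def scale (t : B → ℚ) (ht : ∀ b, t b ≠ 0) : affine B ≅ affine B :=
  Scheme.Spec.mapIso (scaleEquiv t ht).toRingEquiv.toCommRingCatIso.op

/-- [OURS] Unfolding: the underlying morphism is `Spec` of the scaling. -/
theorem scale_hom (t : B → ℚ) (ht : ∀ b, t b ≠ 0) :
    (scale t ht).hom = Spec.map (CommRingCat.ofHom (scaleEquiv t ht).toRingEquiv.toRingHom) := rfl

/-- [OURS] The scaling preserves the open `X_s`: a prime avoids `m_T` iff its scaled preimage does. -/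
theorem scale_mem_stateOpen (s : State) (t : s.B → ℚ) (ht : ∀ b, t b ≠ 0) (x : affine s.B)
    (hx : x ∈ stateOpen s) : (scale t ht).hom x ∈ stateOpen s := by
  unfold stateOpen at hx ⊢
  obtain ⟨T, hT⟩ := TopologicalSpace.Opens.mem_iSup.mp hx
  refine TopologicalSpace.Opens.mem_iSup.mpr ⟨T, ?_⟩
  rw [scale_hom, Spec.map_apply]
  change coMonomial s.B T.1 ∉ Ideal.comap _ x.asIdeal
  rw [Ideal.mem_comap]
  obtain ⟨c, hc, hc0⟩ := scaleHom_coMonomial t T.1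
  change (scaleEquiv t ht) (coMonomial s.B T.1) ∉ x.asIdeal
  rw [scaleEquiv_apply, hc]
  intro hmem
  apply hT
  have hunit : IsUnit (C c : R s.B) := (isUnit_iff_ne_zero.mpr (hc0 ht)).map C
  exact (x.isPrime.mem_or_mem hmem).resolve_left fun h => x.isPrime.ne_top
    (Ideal.eq_top_of_isUnit_mem _ h hunit)

/-- [OURS] **The scaling restricted to `X_s`**: the automorphism `scaleX s t` of the realised scheme with
`scaleX s t ≫ ι = ι ≫ scale t`. -/
def scaleX (s : State) (t : s.B → ℚ) (ht : ∀ b, t b ≠ 0) : X s ⟶ X s :=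
  IsOpenImmersion.lift (stateOpen s).ι ((stateOpen s).ι ≫ (scale t ht).hom) (by
    rintro _ ⟨x, rfl⟩
    refine ⟨⟨(scale t ht).hom x.1, scale_mem_stateOpen s t ht x.1 x.2⟩, ?_⟩
    simp)

/-- [OURS] The defining square of `scaleX`. -/
@[simp] theorem scaleX_ι (s : State) (t : s.B → ℚ) (ht : ∀ b, t b ≠ 0) :
    scaleX s t ht ≫ (stateOpen s).ι = (stateOpen s).ι ≫ (scale t ht).hom :=
  IsOpenImmersion.lift_fac _ _ _

/-! ## The realised triple is its own pull-back along every scaling -/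

/-- [OURS] `Spec` of the scaling, as a ring-hom level formula. -/
theorem scale_hom' (t : B → ℚ) (ht : ∀ b, t b ≠ 0) :
    (scale t ht).hom = Spec.map (CommRingCat.ofHom (scaleHom t).toRingHom) := rfl

/-- [OURS] Composition of scalings of `𝔸^B`: `scale u ≫ scale t = Spec (scaleHom u ∘ scaleHom t)`. -/
theorem scale_hom_comp (t u : B → ℚ) (ht : ∀ b, t b ≠ 0) (hu : ∀ b, u b ≠ 0) :
    (scale u hu).hom ≫ (scale t ht).hom =
      Spec.map (CommRingCat.ofHom (scaleHom fun b => u b * t b).toRingHom) := by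
  rw [scale_hom', scale_hom', ← Spec.map_comp, ← CommRingCat.ofHom_comp]
  congr 2
  change ((scaleHom u).comp (scaleHom t)).toRingHom = _
  rw [scaleHom_comp]

/-- [OURS] A scaling followed by the inverse scaling is the identity of `𝔸^B`. -/
theorem scale_hom_comp_inv (t : B → ℚ) (ht : ∀ b, t b ≠ 0) :
    (scale t ht).hom ≫ (scale (fun b => (t b)⁻¹) (fun b => inv_ne_zero (ht b))).hom = 𝟙 _ := by
  rw [scale_hom_comp]
  have : (fun b => t b * (t b)⁻¹) = fun _ : B => (1 : ℚ) := by funext b; simp [ht b]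
  rw [this, scaleHom_one]
  change Spec.map (𝟙 _) = _
  rw [Spec.map_id]

/-- [OURS] **The scaling of `X_s` as an automorphism** (inverse: the inverse scaling). -/
def scaleXIso (s : State) (t : s.B → ℚ) (ht : ∀ b, t b ≠ 0) : X s ≅ X s where
  hom := scaleX s t ht
  inv := scaleX s (fun b => (t b)⁻¹) (fun b => inv_ne_zero (ht b))
  hom_inv_id := by
    rw [← cancel_mono (stateOpen s).ι, Category.assoc, scaleX_ι, ← Category.assoc, scaleX_ι,
      Category.assoc, scale_hom_comp_inv, Category.comp_id, Category.id_comp]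
  inv_hom_id := by
    rw [← cancel_mono (stateOpen s).ι, Category.assoc, scaleX_ι, ← Category.assoc, scaleX_ι,
      Category.assoc]
    have h := scale_hom_comp_inv (fun b => (t b)⁻¹) (fun b => inv_ne_zero (ht b))
    have ht' : (fun b => ((t b)⁻¹)⁻¹) = t := by funext b; simp
    simp only [ht'] at h
    rw [h, Category.comp_id, Category.id_comp]

/-- [OURS] The scaling of `X_s` is an isomorphism (a theorem, not an instance: use `haveI`). -/
theorem isIso_scaleX (s : State) (t : s.B → ℚ) (ht : ∀ b, t b ≠ 0) : IsIso (scaleX s t ht) :=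
  (scaleXIso s t ht).isIso_hom

/-- [OURS] Surjectivity of the scaling of `X_s` (it is an isomorphism). -/
theorem surjective_scaleX (s : State) (t : s.B → ℚ) (ht : ∀ b, t b ≠ 0) :
    Function.Surjective (scaleX s t ht) :=
  (scaleXIso s t ht).hom.homeomorph.surjective

/-- [OURS] **The realised triple `(X_s, I_s, ∅)` is its own pull-back along every scaling** (Kollár
3.34.1 input): the scaling is a `ℚ`-morphism, pulls the monomial ideal sheaf back to itself, and the
boundary is empty. -/
theorem isPullbackAlong_scaleX (s : State) (hs : s.WF) (hne : s.Str.Nonempty) (t : s.B → ℚ)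
    (ht : ∀ b, t b ≠ 0) :
    (triple s hs hne).IsPullbackAlong (triple s hs hne) (scaleX s t ht) where
  comp_struct := by
    change scaleX s t ht ≫ ((stateOpen s).ι ≫ _) = (stateOpen s).ι ≫ _
    rw [← Category.assoc, scaleX_ι, Category.assoc, scale_hom', ← Spec.map_comp,
      ← CommRingCat.ofHom_comp]
    congr 3
    exact RingHom.ext fun a => (scaleHom t).commutes a
  ideal_eq := by
    change ideal s = (ideal s).comap (scaleX s t ht)
    unfold ideal
    rw [← Scheme.IdealSheafData.comap_comp, scaleX_ι, Scheme.IdealSheafData.comap_comp, scale_hom',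
      affineBlowup.comap_idealSheaf_specMap]
    congr 2
    exact (map_scale_genIdeal s t ht).symm
  boundary_eq := by simp

/-- [OURS · Route K, step K3(a)] **Every centre of the functorial resolution of the realisation is
scaling-stable, at every level**: the functor's sequence is its own pull-back along each scaling
(`CentreSeq.IsPullbackAlong`; unfold with `isPullbackAlong_cons_cons`: `C = C.comap (scaleX s t)` and
the tail is its own pull-back along the lifted automorphism of `Bl_C X_s`). -/
theorem selfPullback_of_functorial (s : State) (hs : s.WF) (hne : s.Str.Nonempty)
    {B' : Kollar2007.BlowupSequenceFunctor (dim s hne)}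
    (hcomm : Kollar2007.CommutesWithSmoothMorphisms (Kollar2007.TripleClass.all (dim s hne)) B')
    (t : s.B → ℚ) (ht : ∀ b, t b ≠ 0) :
    CentreSeq.IsPullbackAlong (scaleX s t ht) (B' (triple s hs hne)) (B' (triple s hs hne)) := by
  haveI := isIso_scaleX s t ht
  haveI : IsOpenImmersion (scaleX s t ht) := IsOpenImmersion.of_isIso _
  haveI : Smooth (scaleX s t ht) := SmoothOfRelativeDimension.smooth 0 _
  have h := (@hcomm ℚ _ _ (triple s hs hne) (triple s hs hne) (scaleX s t ht) ‹_› trivial trivial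
    (isPullbackAlong_scaleX s hs hne t ht)).1 ⟨surjective_scaleX s t ht⟩
  conv_rhs => rw [h]
  exact CentreSeq.isPullbackAlong_comap _ _

/-- [OURS] **First consequence: the first centre is scaling-stable.** -/
theorem comap_head_eq (s : State) (t : s.B → ℚ) (ht : ∀ b, t b ≠ 0) {C : (X s).IdealSheafData}
    {rest : CentreSeq (blowup C)} (h : CentreSeq.IsPullbackAlong (scaleX s t ht)
      (CentreSeq.cons C rest) (CentreSeq.cons C rest)) :
    C.comap (scaleX s t ht) = C :=
  ((CentreSeq.isPullbackAlong_cons_cons _ _ _ _ _).mp h).1.symm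

end RouteK

end PolyhedraGame

end Summit.ResolutionOfSingularities.ResolutionOfSingularities.Theorems

end
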